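import Literature.AlgebraicGeometry.Hu2025.Proofs.S03Pluecker.GammaQuadTorusInvariance
import HarnessLib

/-!
# Hu 2025 / [Hu22] p.131–132 — the torus action on the quad cell with weights in an ARBITRARY target ring:
# `scaleTo g σ : Rh → B`, `x̄_u ↦ c_u(σ) · g(x̄_u)` (joint J1 / GAP-LEDGER-HU row HU-R01, reading (β) — kernel support, OURS;
# the technical step for the torsor isomorphism `Gr_d ≅ (Gr_d/T) × 𝔾⁸_m` of `GammaQuadTorusTorsor.lean`)

**HONEST FRAMING (D-0012/D-0089).** [Hu2025] (arXiv:2507.21400v1) and [Hu2022] (arXiv:2203.03842v4) are unrefereed preprints under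
adjudication; nothing of them is asserted. OURS objects only (sequel of `GammaQuadTorus.lean` / `GammaQuadTorusInvariance.lean`).

[Hu22] p.132 l.30–51 glosses the quotient map `π : Gr_d → Gr̄_d` of p.131 l.10–16 as «a principal `(𝔾ⁿ_m/𝔾_m)`-bundle … (9.4)
`Gr_d|_O ≅ O × (𝔾ⁿ_m/𝔾_m)` … `(𝔾ⁿ_m/𝔾_m) ≅ 𝔾^{n−1}_m = Spec 𝔽[s^±_1, ⋯, s^±_{n−1}]`» (typed by res-type-024 as `quot_trivialises` of
`Hu22Setup_printed(_ours)`, row 110 g/h). For the kernel torsor isomorphism of the quad cell one needs the torus scaling with weights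
valued in the TARGET ring (the Laurent ring over the slice), not in `Rh` itself. THIS FILE generalises `QuadTorus.scale`: for any
ring map `g : Rh → B` and column weights `σ : ℕ → Bˣ`, the ring map `scaleTo g σ : Rh → B`, `x̄_u ↦ c_u(σ) · g(x̄_u)`
(`scaleTo_m`), `A_{a,i} ↦ (σ_a/σ_{i+1}) · g(A_{a,i})` (`scaleTo_A`), constants preserved (`scaleTo_toRh_C`) — well defined because the
Γ-scheme ideal is multi-homogeneous (`scaleTo₀_gammaChartIdeal`). AI proof is weaker than expert review.
-/

noncomputable section

namespace Literature.AlgebraicGeometry.Hu2025.Statements.S03Pluecker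

open MvPolynomial Matrix

namespace QuadTorus

open QuadCell

variable (k : Type) [Field k] {B : Type} [CommRing B]

/-! ## Weights in an arbitrary ring -/

/-- The weight `c_t(σ) = σ₁⁻¹σ₂⁻¹σ₃⁻¹ σ_{t₁}σ_{t₂}σ_{t₃}` as a unit of `B`. OURS plumbing.
[cite: Hu2025, Thm. 9.3/9.4 («the action of 𝔾ⁿ_m/𝔾_m on Gr^{d,n}_d») p.160–161; [Hu22] p.132 l.30–51; joint J1 = GAP-LEDGER-HU row HU-R01 (unrefereed preprints under adjudication, D-0012/D-0089 — kernel support on OUR typed carriers of rows 101/110; nothing of the sources asserted)] -/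
def cwB (σ : ℕ → Bˣ) (t : ℕ × ℕ × ℕ) : Bˣ := (σ 1)⁻¹ * (σ 2)⁻¹ * (σ 3)⁻¹ * σ t.1 * σ t.2.1 * σ t.2.2

/-- Row weights `r_i = σ_{i+1}⁻¹` as units of `B`. OURS plumbing.
[cite: Hu2025, Thm. 9.3/9.4 p.160–161; [Hu22] p.132 l.30–51; joint J1 = GAP-LEDGER-HU row HU-R01 (unrefereed preprints under adjudication, D-0012/D-0089 — kernel support on OUR typed carriers of rows 101/110; nothing of the sources asserted)] -/
def rwB (σ : ℕ → Bˣ) (i : Fin 3) : Bˣ :=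
  match i with
  | 0 => (σ 1)⁻¹
  | 1 => (σ 2)⁻¹
  | 2 => (σ 3)⁻¹

/-- `c_t(σ) = r₀ r₁ r₂ σ_{t₁} σ_{t₂} σ_{t₃}` in `B`.
[cite: Hu2025, Thm. 9.3/9.4 p.160–161; joint J1 = GAP-LEDGER-HU row HU-R01 (unrefereed preprints under adjudication, D-0012/D-0089 — kernel support on OUR typed carriers of rows 101/110; nothing of the sources asserted)] -/
theorem coe_cwB (σ : ℕ → Bˣ) (t : ℕ × ℕ × ℕ) :
    (cwB σ t : B) = rwB σ 0 * rwB σ 1 * rwB σ 2 * σ t.1 * σ t.2.1 * σ t.2.2 := by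
  simp only [cwB, rwB, Units.val_mul]

/-- `r_i σ_{i+1} = 1` in `B`.
[cite: Hu2025, Thm. 9.3/9.4 p.160–161; joint J1 = GAP-LEDGER-HU row HU-R01 (unrefereed preprints under adjudication, D-0012/D-0089 — kernel support on OUR typed carriers of rows 101/110; nothing of the sources asserted)] -/
theorem rwB_mul (σ : ℕ → Bˣ) :
    (rwB σ 0 : B) * σ 1 = 1 ∧ (rwB σ 1 : B) * σ 2 = 1 ∧ (rwB σ 2 : B) * σ 3 = 1 := by
  refine ⟨?_, ?_, ?_⟩ <;> simp only [rwB, Units.inv_mul]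

/-- Ring maps transport weights: `f (c_t(σ)) = c_t(f ∘ σ)` (as units).
[cite: Hu2025, Thm. 9.3/9.4 p.160–161; joint J1 = GAP-LEDGER-HU row HU-R01 (unrefereed preprints under adjudication, D-0012/D-0089 — kernel support on OUR typed carriers of rows 101/110; nothing of the sources asserted)] -/
theorem map_cwB {B' : Type} [CommRing B'] (f : B →+* B') (σ : ℕ → Bˣ) (t : ℕ × ℕ × ℕ) :
    Units.map (f : B →* B') (cwB σ t) = cwB (fun a => Units.map (f : B →* B') (σ a)) t := by
  simp only [cwB, map_mul, map_inv]

/-- In `Rh` the new weights agree with `cwU` of `GammaQuadTorusInvariance`.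
[cite: Hu2025, Thm. 9.3/9.4 p.160–161; joint J1 = GAP-LEDGER-HU row HU-R01 (unrefereed preprints under adjudication, D-0012/D-0089 — kernel support on OUR typed carriers of rows 101/110; nothing of the sources asserted)] -/
theorem cwB_eq_cwU (σ : ℕ → (Rh k)ˣ) (t : ℕ × ℕ × ℕ) : cwB σ t = cwU k σ t := rfl

/-! ## The scaled evaluation with values in `B` -/

variable (g : Rh k →+* B) (σ : ℕ → Bˣ)

/-- **Scaled evaluation of the basic variables in `B`**: `x_{(ija)} ↦ c_{(ija)}(σ) · g(x̄_{(ija)})`. OURS.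
[cite: Hu2025, Thm. 9.3/9.4 («the action of 𝔾ⁿ_m/𝔾_m on Gr^{d,n}_d») p.160–161 / Prop. 3.6 p.38; [Hu22] p.132 l.30–51; joint J1 = GAP-LEDGER-HU row HU-R01 (unrefereed preprints under adjudication, D-0012/D-0089 — kernel support on OUR typed carriers of rows 101/110; nothing of the sources asserted)] -/
def ψB : BasicRing 9 k →+* B :=
  MvPolynomial.eval₂Hom (g.comp ((toRh k).comp MvPolynomial.C))
    fun x => (cwB σ x.1.1 : B) * g (toRh k (basicIncl 9 k (X x)))

/-- `ψB` on a basic variable.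
[cite: Hu2025, Thm. 9.3/9.4 p.160–161 / Prop. 3.6 p.38; joint J1 = GAP-LEDGER-HU row HU-R01 (unrefereed preprints under adjudication, D-0012/D-0089 — kernel support on OUR typed carriers of rows 101/110; nothing of the sources asserted)] -/
theorem ψB_bvar {t : ℕ × ℕ × ℕ} (h : t ∈ plVarSet 9) (hb : ¬ IsLt t) : ψB k g σ (bvar k t) = cwB σ t * g (m k t) := by
  rw [bvar_of_mem k h hb, ψB, MvPolynomial.eval₂Hom_X', ← bvar_of_mem k h hb, basicIncl_bvar k h hb]
  rfl

/-- **`ψB ∘ chartCol a = ((σ_a/σ_{i+1}) · g(A_{a,i}))_i`** for `1 ≤ a ≤ 9`.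
[cite: Hu2025, Thm. 9.3/9.4 («the action of 𝔾ⁿ_m/𝔾_m on Gr^{d,n}_d») p.160–161 / Prop. 3.6 p.38; [Hu22] p.132 l.30–51; joint J1 = GAP-LEDGER-HU row HU-R01 (unrefereed preprints under adjudication, D-0012/D-0089 — kernel support on OUR typed carriers of rows 101/110; nothing of the sources asserted)] -/
theorem ψB_chartCol {a : ℕ} (ha1 : 1 ≤ a) (ha9 : a ≤ 9) :
    (ψB k g σ) ∘ chartCol k a = fun i => ((rwB σ i : B) * σ a) * g (A k a i) := by
  obtain ⟨h1, h2, h3⟩ := rwB_mul σ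
  by_cases ha : 3 < a
  · have h23 : ((2, 3, a) : ℕ × ℕ × ℕ) ∈ plVarSet 9 := mem_plVarSet (by norm_num) (by norm_num) ha ha9 ha
    have h13 : ((1, 3, a) : ℕ × ℕ × ℕ) ∈ plVarSet 9 := mem_plVarSet (by norm_num) (by norm_num) ha ha9 ha
    have h12 : ((1, 2, a) : ℕ × ℕ × ℕ) ∈ plVarSet 9 := mem_plVarSet (by norm_num) (by norm_num) (by omega) ha9 ha
    have n23 : ¬ IsLt ((2, 3, a) : ℕ × ℕ × ℕ) := not_isLt_of_le (by norm_num) (by norm_num) le_rfl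
    have n13 : ¬ IsLt ((1, 3, a) : ℕ × ℕ × ℕ) := not_isLt_of_le (by norm_num) (by norm_num) le_rfl
    have n12 : ¬ IsLt ((1, 2, a) : ℕ × ℕ × ℕ) := not_isLt_of_le (by norm_num) (by norm_num) (by norm_num)
    rw [chartCol_of_lt k ha, A_of_lt k ha ha9]
    refine vec3_eq ?_ ?_ ?_
    · simp only [Function.comp_apply, Matrix.cons_val_zero, ψB_bvar k g σ h23 n23, coe_cwB]
      linear_combination ((rwB σ 0 : B) * (σ a : B) * g (m k (2, 3, a)) * (rwB σ 2 : B) * (σ 3 : B)) * h2 +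
        ((rwB σ 0 : B) * (σ a : B) * g (m k (2, 3, a))) * h3
    · simp only [Function.comp_apply, Matrix.cons_val_one, Matrix.cons_val_zero, map_neg, ψB_bvar k g σ h13 n13, coe_cwB]
      linear_combination (-((rwB σ 1 : B) * (σ a : B) * g (m k (1, 3, a)) * (rwB σ 2 : B) * (σ 3 : B))) * h1 -
        ((rwB σ 1 : B) * (σ a : B) * g (m k (1, 3, a))) * h3
    · simp only [Function.comp_apply, Matrix.cons_val_two, Matrix.tail_cons, Matrix.head_cons, ψB_bvar k g σ h12 n12,
        coe_cwB]
      linear_combination ((rwB σ 2 : B) * (σ a : B) * g (m k (1, 2, a)) * (rwB σ 1 : B) * (σ 2 : B)) * h1 +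
        ((rwB σ 2 : B) * (σ a : B) * g (m k (1, 2, a))) * h2
  · obtain ⟨f1, f2, f3⟩ := A_frame k
    have ha' : a = 1 ∨ a = 2 ∨ a = 3 := by omega
    rcases ha' with rfl | rfl | rfl
    · rw [chartCol_one, f1]; refine vec3_eq ?_ ?_ ?_ <;> simp [ψB, h1]
    · rw [chartCol_two, f2]; refine vec3_eq ?_ ?_ ?_ <;> simp [ψB, h2]
    · rw [chartCol_three, f3]; refine vec3_eq ?_ ?_ ?_ <;> simp [ψB, h3]

/-- **The chart minors are multi-homogeneous**: `ψB (chartMinor u) = c_u(σ) · g(det(A_{u₁}, A_{u₂}, A_{u₃}))`.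
[cite: Hu2025, Thm. 9.3/9.4 («the action of 𝔾ⁿ_m/𝔾_m on Gr^{d,n}_d») p.160–161 / Prop. 3.6 p.38; [Hu22] p.132 l.30–51; joint J1 = GAP-LEDGER-HU row HU-R01 (unrefereed preprints under adjudication, D-0012/D-0089 — kernel support on OUR typed carriers of rows 101/110; nothing of the sources asserted)] -/
theorem ψB_chartMinor {u : ℕ × ℕ × ℕ} (hu : u ∈ plIndexSet 9) :
    ψB k g σ (chartMinor k u) = cwB σ u * g (det3 (A k u.1) (A k u.2.1) (A k u.2.2)) := by
  have hidx := mem_plIndexSet_iff.mp hu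
  have h := map_det3 (ψB k g σ) (chartCol k u.1) (chartCol k u.2.1) (chartCol k u.2.2)
  rw [chartMinor]
  erw [h]
  rw [ψB_chartCol k g σ (a := u.1) (by omega) (by omega), ψB_chartCol k g σ (a := u.2.1) (by omega) (by omega),
    ψB_chartCol k g σ (a := u.2.2) (by omega) (by omega), det3_weights, coe_cwB, map_det3]
  rfl

/-- **`scaleTo₀ g σ : k[x_u] → B`**, `x_u ↦ c_u(σ) · g(x̄_u)` (`= ψB ∘ chartParam`). OURS.
[cite: Hu2025, Thm. 9.3/9.4 p.160–161 / Prop. 3.6 p.38; [Hu22] p.132 l.30–51; joint J1 = GAP-LEDGER-HU row HU-R01 (unrefereed preprints under adjudication, D-0012/D-0089 — kernel support on OUR typed carriers of rows 101/110; nothing of the sources asserted)] -/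
def scaleTo₀ : ChartRing 9 k →+* B := (ψB k g σ).comp (chartParam 9 k).toRingHom

/-- `scaleTo₀ (x̄_u) = c_u(σ) · g(m u)` for chart indices `u`.
[cite: Hu2025, Thm. 9.3/9.4 p.160–161 / Prop. 3.6 p.38; joint J1 = GAP-LEDGER-HU row HU-R01 (unrefereed preprints under adjudication, D-0012/D-0089 — kernel support on OUR typed carriers of rows 101/110; nothing of the sources asserted)] -/
theorem scaleTo₀_xbar {u : ℕ × ℕ × ℕ} (hu : u ∈ plVarSet 9) : scaleTo₀ k g σ (xbar k u) = cwB σ u * g (m k u) := by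
  rw [scaleTo₀, RingHom.comp_apply, AlgHom.toRingHom_eq_coe, RingHom.coe_coe, chartParam_xbar k hu,
    ψB_chartMinor k g σ (Finset.mem_erase.mp hu).2, ← m_eq_det3 k hu]

/-- `scaleTo₀` on constants.
[cite: Hu2025, Thm. 9.3/9.4 p.160–161; joint J1 = GAP-LEDGER-HU row HU-R01 (unrefereed preprints under adjudication, D-0012/D-0089 — kernel support on OUR typed carriers of rows 101/110; nothing of the sources asserted)] -/
theorem scaleTo₀_C (c : k) : scaleTo₀ k g σ (C c) = g (toRh k (C c)) := by
  rw [scaleTo₀, RingHom.comp_apply, AlgHom.toRingHom_eq_coe, RingHom.coe_coe, MvPolynomial.algHom_C,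
    MvPolynomial.algebraMap_eq, ψB, MvPolynomial.eval₂Hom_C, RingHom.comp_apply, RingHom.comp_apply]

/-- **`scaleTo₀` kills the Γ-scheme ideal** (multi-homogeneity of the Plücker/Γ relations).
[cite: Hu2025, Def. 7.1 (I_{℘,Γ}) p.128 / Prop. 3.6 p.38 / Thm. 9.3/9.4 p.160–161; [Hu22] p.132 l.30–51; joint J1 = GAP-LEDGER-HU row HU-R01 (unrefereed preprints under adjudication, D-0012/D-0089 — kernel support on OUR typed carriers of rows 101/110; nothing of the sources asserted)] -/
theorem scaleTo₀_gammaChartIdeal : ∀ F ∈ gammaChartIdeal k 9 quadGamma, scaleTo₀ k g σ F = 0 := by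
  intro F hF
  rw [mem_gammaChartIdeal_iff k (quadGamma_subset le_rfl)] at hF
  have hle : gammaMinorIdeal k 9 quadGamma ≤ RingHom.ker (ψB k g σ) := by
    unfold gammaMinorIdeal
    rw [Ideal.span_le]
    rintro _ ⟨u, hu, rfl⟩
    have hu' : u ∈ plVarSet 9 := quadGamma_subset le_rfl hu
    rw [SetLike.mem_coe, RingHom.mem_ker, ψB_chartMinor k g σ (Finset.mem_erase.mp hu').2, ← m_eq_det3 k hu', m_gamma k hu,
      map_zero, mul_zero]
  have := hle hF
  rw [RingHom.mem_ker] at this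
  rw [scaleTo₀, RingHom.comp_apply]
  exact this

/-- **`scaleTo_q g σ : Rq → B`**. OURS.
[cite: Hu2025, Def. 7.1 (Z_Γ) p.128 / Thm. 9.3/9.4 p.160–161; [Hu22] p.132 l.30–51; joint J1 = GAP-LEDGER-HU row HU-R01 (unrefereed preprints under adjudication, D-0012/D-0089 — kernel support on OUR typed carriers of rows 101/110; nothing of the sources asserted)] -/
def scaleToq : Rq k →+* B :=
  Ideal.Quotient.lift (gammaChartIdeal k 9 quadGamma) (scaleTo₀ k g σ) (scaleTo₀_gammaChartIdeal k g σ)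

/-- `scaleTo_q g σ (hq)` is a unit.
[cite: Hu2025, Prop. 9.1 (Gr_d) p.160 / Thm. 9.3/9.4 p.160–161; joint J1 = GAP-LEDGER-HU row HU-R01 (unrefereed preprints under adjudication, D-0012/D-0089 — kernel support on OUR typed carriers of rows 101/110; nothing of the sources asserted)] -/
theorem isUnit_scaleToq_hq : IsUnit (scaleToq k g σ (hq k)) := by
  show IsUnit (scaleToq k g σ (Ideal.Quotient.mk _ (hprod k)))
  rw [scaleToq, Ideal.Quotient.lift_mk, hprod, map_prod, IsUnit.prod_iff]
  intro u hu
  rw [scaleTo₀_xbar k g σ (Finset.mem_filter.mp hu).1]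
  exact (Units.isUnit _).mul ((isUnit_m k hu).map g)

/-- **`scaleTo g σ : Rh → B`** — the torus scaling with weights `σ` in `B` on top of the ring map `g`
(`x̄_u ↦ (σ_{u₁}σ_{u₂}σ_{u₃}/σ₁σ₂σ₃) · g(x̄_u)`). OURS.
[cite: Hu2025, Thm. 9.3/9.4 («the action of 𝔾ⁿ_m/𝔾_m on Gr^{d,n}_d») p.160–161; [Hu22] p.132 l.30–51 ((9.4), the trivialisations); joint J1 = GAP-LEDGER-HU row HU-R01 (unrefereed preprints under adjudication, D-0012/D-0089 — kernel support on OUR typed carriers of rows 101/110; nothing of the sources asserted)] -/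
def scaleTo : Rh k →+* B := IsLocalization.Away.lift (hq k) (isUnit_scaleToq_hq k g σ)

/-- `scaleTo g σ (toRh F) = scaleTo₀ g σ F`.
[cite: Hu2025, Thm. 9.3/9.4 p.160–161; joint J1 = GAP-LEDGER-HU row HU-R01 (unrefereed preprints under adjudication, D-0012/D-0089 — kernel support on OUR typed carriers of rows 101/110; nothing of the sources asserted)] -/
theorem scaleTo_toRh (F : ChartRing 9 k) : scaleTo k g σ (toRh k F) = scaleTo₀ k g σ F := by
  rw [toRh, RingHom.comp_apply, scaleTo, IsLocalization.Away.lift_eq, scaleToq, Ideal.Quotient.lift_mk]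

/-- **`scaleTo g σ (m u) = c_u(σ) · g(m u)`** for chart indices `u`.
[cite: Hu2025, Thm. 9.3/9.4 («the action of 𝔾ⁿ_m/𝔾_m on Gr^{d,n}_d») p.160–161; [Hu22] p.132 l.30–51; joint J1 = GAP-LEDGER-HU row HU-R01 (unrefereed preprints under adjudication, D-0012/D-0089 — kernel support on OUR typed carriers of rows 101/110; nothing of the sources asserted)] -/
theorem scaleTo_m {u : ℕ × ℕ × ℕ} (hu : u ∈ plVarSet 9) : scaleTo k g σ (m k u) = cwB σ u * g (m k u) := by
  rw [m, scaleTo_toRh, scaleTo₀_xbar k g σ hu, m]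

/-- **`scaleTo g σ (A_{a,i}) = (σ_a/σ_{i+1}) · g(A_{a,i})`** (`1 ≤ a ≤ 9`).
[cite: Hu2025, Thm. 9.3/9.4 («the action of 𝔾ⁿ_m/𝔾_m on Gr^{d,n}_d») p.160–161; [Hu22] p.132 l.30–51; joint J1 = GAP-LEDGER-HU row HU-R01 (unrefereed preprints under adjudication, D-0012/D-0089 — kernel support on OUR typed carriers of rows 101/110; nothing of the sources asserted)] -/
theorem scaleTo_A {a : ℕ} (ha1 : 1 ≤ a) (ha9 : a ≤ 9) (i : Fin 3) :
    scaleTo k g σ (A k a i) = ((rwB σ i : B) * σ a) * g (A k a i) := by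
  have h := congrFun (ψB_chartCol k g σ ha1 ha9) i
  rw [Function.comp_apply] at h
  rw [A, Function.comp_apply, Function.comp_apply, scaleTo_toRh, scaleTo₀, RingHom.comp_apply, AlgHom.toRingHom_eq_coe,
    RingHom.coe_coe, chartParam_basicIncl, h, A, Function.comp_apply, Function.comp_apply]

/-- **`scaleTo g σ` on constants**: `scaleTo g σ (toRh (C c)) = g (toRh (C c))`.
[cite: Hu2025, Thm. 9.3/9.4 p.160–161; joint J1 = GAP-LEDGER-HU row HU-R01 (unrefereed preprints under adjudication, D-0012/D-0089 — kernel support on OUR typed carriers of rows 101/110; nothing of the sources asserted)] -/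
theorem scaleTo_toRh_C (c : k) : scaleTo k g σ (toRh k (C c)) = g (toRh k (C c)) := by
  rw [scaleTo_toRh, scaleTo₀_C]

end QuadTorus

end Literature.AlgebraicGeometry.Hu2025.Statements.S03Pluecker

end
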